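import Literature.MathematicalPhysics.QuantumLattice.TorusSectorGibbsCondEntropyRow
import HarnessLib

/-!
# Entropy rows as EXTRA ROWS `0 ≤ Re ω(G_e)` of the thermal certificate reader

Topic `MathematicalPhysics/QuantumLattice`; reader-facing packaging of `TorusSectorGibbsEntropyRowLimit.lean`
(«ent»: `e_Φ(ω) − Re ω_B(G)/(β|B|) ≤ e(n) + log Tr e^{−G}/(β|B|)`) and `TorusSectorGibbsCondEntropyRow.lean`
(«cent»: `e_Φ(ω) − Re ω_Λ(H)/β ≤ e(n) + c/β`). The thermal certificate reader
(`HubbardTTPrimeThermalWindowCertificate(Symm).lean`, `…re_expect_ge_of_thermal_certificate_symm_TT'_of_sectorGibbs`)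
accepts a family of extra rows `G_e ∈ 𝔄_{Λ'}` with the hypothesis `0 ≤ Re ω_{Λ'}(G_e)`; here the two entropy
rows are put in exactly that shape, for the certificate region `Λ' ⊇ thicken {0} 1` (the support of the
mean-energy observable `E_Φ`) containing the box `B` / window `Λ`, given a certified upper bound `f` on the
ground-state energy density `e(t,t',U,n)` (an input row of record) and an upper bound `c` on the
constant:

* `IsTorusLimitOfMixture.re_expect_entRow_nonneg_of_sectorGibbs`:
  `0 ≤ Re ω_{Λ'}((f + c)·1 − Γ E_Φ + (1/(β|B|))·Γ_{B⊆Λ'} G)` whenever `log Re Tr e^{−G}/(β|B|) ≤ c`;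
* `IsTorusLimitOfMixture.re_expect_centRow_nonneg_of_sectorGibbs`:
  `0 ≤ Re ω_{Λ'}((f + c/β)·1 − Γ E_Φ + (1/β)·Γ_{Λ⊆Λ'} H)` for a dual certificate `(L_B, c)`.

Everything is PROVED (linearity of `ω_{Λ'}`, `ω_{Λ'}(1) = 1`, compatibility `ω_{Λ'}(Γ A) = ω(A)`,
`e_Φ(ω) = Re ω(E_Φ)` by definition); no definition, no named fact. (The underlying torus-limit rows are
`QuantumLattice.IsTorusLimitOfMixture.meanEnergy_sub_re_expect_div_le_of_sectorGibbs_box/_window` — note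
the namespace: refer to them by these full names.)

References: Israel 1979 Lemma II.3.1 [Israel1979]; Araki–Moriya 2003 Thm. 3.8/§10 [ArakiMoriya2003];
Poulin–Hastings 2011 eqs. (3)–(8) [PoulinHastings2011].
-/

noncomputable section

namespace Literature.MathematicalPhysics.QuantumLattice

open Matrix Finset HubbardWave0 Literature.Probability.LatticeModels ThermodynamicLimit
open _root_.Filter
open scoped _root_.Topology ComplexOrder BigOperators

namespace InfVolFermionState

/-! ### The rows as extra rows `G_e` of the reader -/

/-- Evaluation of an affine extra row: `Re ω_{Λ'}(r·1 − Γ E_Φ + s·Γ A) = r − e_Φ(ω) + s·Re ω(A)`. [folklore] -/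
private theorem re_expect_affineRow (ω : InfVolFermionState 2) (t t' U : ℝ) {Λ Λ' : Finset (Site 2)}
    (hΛ : Λ ⊆ Λ') (h0 : thicken ({0} : Finset (Site 2)) 1 ⊆ Λ') (A : FermionOp Λ) (r s : ℝ) :
    (ω.expect Λ' (((r : ℝ) : ℂ) • (1 : FermionOp Λ') -
        fermionEmbed (PolySite.incl h0) ((hubbardTTPrimeFermionInteraction t t' U).meanEnergyObs 1) +
        ((s : ℝ) : ℂ) • fermionEmbed (PolySite.incl hΛ) A)).re =
      r - ω.meanEnergy (hubbardTTPrimeFermionInteraction t t' U) 1 + s * (ω.expect Λ A).re := by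
  rw [map_add, map_sub, map_smul, map_smul, ω.expect_one, ω.compatible h0, ω.compatible hΛ, meanEnergy]
  simp only [smul_eq_mul, mul_one, Complex.add_re, Complex.sub_re, Complex.ofReal_re, Complex.re_ofReal_mul]

/-- **The «ent» row as an extra row of the thermal reader.** For every torus limit `ω` of the canonical
sector Gibbs states of `hubbardTorusTT' L t t' U` at `β > 0` (`U ≥ 0`, `0 ≤ n < 2`), a rectangle
`B = ∏[0,m_i) ⊆ Λ'` (`m_i > 0`), a Hermitian witness `G ∈ 𝔄_B`, an input row `e(t,t',U,n) ≤ f` and a constant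
`log Re Tr e^{−G}/(β|B|) ≤ c`: `0 ≤ Re ω_{Λ'}((f + c)·1 − Γ E_Φ + (1/(β∏m_i))·Γ_{B⊆Λ'} G)` — the hypothesis
`hG` of `…re_expect_ge_of_thermal_certificate_symm_TT'_of_sectorGibbs` for this `G_e`.
[cite: Israel1979, Lemma II.3.1] [cite: ArakiMoriya2003, Theorem 3.8 and §10] -/
theorem IsTorusLimitOfMixture.re_expect_entRow_nonneg_of_sectorGibbs
    (t t' : ℝ) {U : ℝ} (hU : 0 ≤ U) {n : ℝ} (hn0 : 0 ≤ n) (hn2 : n < 2) {β : ℝ} (hβ : 0 < β)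
    {ω : InfVolFermionState 2} {Ls : ℕ → ℕ}
    (h : ω.IsTorusLimitOfMixture (sectorGibbsCount n) (fun L => sectorGibbsWeightTT' β t t' U n L)
      (fun L => sectorGibbsVectorTT' t t' U n L) Ls)
    (hLs : Tendsto Ls atTop atTop) {m : Fin 2 → ℕ} (hm : ∀ i, 0 < m i)
    {G : FermionOp (halfOpenRect m)} (hG : G.IsHermitian)
    {Λ' : Finset (Site 2)} (hB : halfOpenRect m ⊆ Λ') (h0 : thicken ({0} : Finset (Site 2)) 1 ⊆ Λ')
    {f c : ℝ} (hf : energyDensityTT' t t' U n ≤ f)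
    (hc : Real.log (partitionFn 1 G).re / (β * ∏ i, (m i : ℝ)) ≤ c) :
    0 ≤ (ω.expect Λ' ((((f + c : ℝ)) : ℂ) • (1 : FermionOp Λ') -
        fermionEmbed (PolySite.incl h0) ((hubbardTTPrimeFermionInteraction t t' U).meanEnergyObs 1) +
        ((1 / (β * ∏ i, (m i : ℝ)) : ℝ) : ℂ) • fermionEmbed (PolySite.incl hB) G)).re := by
  rw [re_expect_affineRow]
  have hrow := QuantumLattice.IsTorusLimitOfMixture.meanEnergy_sub_re_expect_div_le_of_sectorGibbs_box t t' hU
    hn0 hn2 hβ h hLs hm hG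
  linarith

/-- **The «cent» row as an extra row of the thermal reader.** For every torus limit `ω` of the canonical
sector Gibbs states at `β > 0` (`U ≥ 0`, `0 ≤ n < 2`), a window `Λ ⊆ [0,ℓ)²`, `Λ ⊆ Λ'`, with lexicographically
largest site `a`, Hermitian `H ∈ 𝔄_Λ`, `L_B ∈ 𝔄_{Λ∖a}`, a real `c` with the dual certificate
`e^c·e^{L_B} − tr_{Λ→Λ∖a} exp(−H + Γ L_B) ⪰ 0`, and an input row `e(t,t',U,n) ≤ f`:
`0 ≤ Re ω_{Λ'}((f + c/β)·1 − Γ E_Φ + (1/β)·Γ_{Λ⊆Λ'} H)`.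
[cite: PoulinHastings2011, eqs. (3)–(8)] [cite: ArakiMoriya2003, Theorem 3.8 and §10] -/
theorem IsTorusLimitOfMixture.re_expect_centRow_nonneg_of_sectorGibbs
    (t t' : ℝ) {U : ℝ} (hU : 0 ≤ U) {n : ℝ} (hn0 : 0 ≤ n) (hn2 : n < 2) {β : ℝ} (hβ : 0 < β)
    {ω : InfVolFermionState 2} {Ls : ℕ → ℕ}
    (h : ω.IsTorusLimitOfMixture (sectorGibbsCount n) (fun L => sectorGibbsWeightTT' β t t' U n L)
      (fun L => sectorGibbsVectorTT' t t' U n L) Ls)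
    (hLs : Tendsto Ls atTop atTop) {Λ : Finset (Site 2)} {a : Site 2} (ha : a ∈ Λ)
    (hmax : ∀ y ∈ Λ, toLex y ≤ toLex a) {ℓ : ℕ} (hΛℓ : Λ ⊆ halfOpenBox 2 ℓ)
    {H : FermionOp Λ} (hH : H.IsHermitian) {LB : FermionOp (Λ.erase a)} (hLB : LB.IsHermitian) {c : ℝ}
    (hcert : ((Real.exp c : ℂ) • cfc Real.exp LB -
      fermionPartialTrace (PolySite.incl (Finset.erase_subset a Λ))
        (cfc Real.exp (-H + fermionEmbed (PolySite.incl (Finset.erase_subset a Λ)) LB))).PosSemidef)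
    {Λ' : Finset (Site 2)} (hΛ : Λ ⊆ Λ') (h0 : thicken ({0} : Finset (Site 2)) 1 ⊆ Λ')
    {f : ℝ} (hf : energyDensityTT' t t' U n ≤ f) :
    0 ≤ (ω.expect Λ' ((((f + c / β : ℝ)) : ℂ) • (1 : FermionOp Λ') -
        fermionEmbed (PolySite.incl h0) ((hubbardTTPrimeFermionInteraction t t' U).meanEnergyObs 1) +
        ((1 / β : ℝ) : ℂ) • fermionEmbed (PolySite.incl hΛ) H)).re := by
  rw [re_expect_affineRow]
  have hrow := QuantumLattice.IsTorusLimitOfMixture.meanEnergy_sub_re_expect_div_le_of_sectorGibbs_window t t' hU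
    hn0 hn2 hβ h hLs ha hmax hΛℓ hH hLB hcert
  linarith

end InfVolFermionState

end Literature.MathematicalPhysics.QuantumLattice

end
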